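import Literature.Analysis.FluidPDE.CriticalRegularity
import Literature.Analysis.FluidPDE.VectorCalculus
import HarnessLib

/-!
# Barrier: sharp norm inflation for Navier–Stokes in SUPERCRITICAL Besov spaces
# (X. Luo 2025, Thm. 1.1)

Barrier catalogue entry for `NavierStokesRegularity` (D-0021): the supercritical extension of
`Literature.Barriers.NavierStokesRegularity.CriticalBesovNormInflation` (Bourgain–Pavlović 2008,
the largest CRITICAL space `Ḃ^{-1}_{∞,∞}`, whose scope_caveats (e) records "the classical statement
printed is for `s = 1` only"), and the sibling of
`Literature.Barriers.NavierStokesRegularity.SupercriticalVorticityBurst` (the SAME source, Thm. 1.3,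
whose scope_caveats (b) records "the inflation statement Thm. 1.1 … is NOT recorded"). Vendors
**Theorem 1.1** of X. Luo, *Sharp norm inflation for 3D Navier–Stokes equations in supercritical
spaces*, arXiv:2504.08288 (2025) [`Luo2025`] as ONE named fact `SupercriticalBesovNormInflation`
over exactly the vocabulary of the Thm. 1.3 sibling (classical solutions
`Literature.Analysis.FluidPDE.IsClassicalNSSolutionOn`, pointwise divergence-freeness
`Literature.Analysis.FluidPDE.VectorCalculus.IsDivFree`, the tempered distribution of a field
`Literature.Analysis.FluidPDE.IsDistributionOf`, the homogeneous Littlewood–Paley Besov norms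
`Literature.Analysis.FunctionSpaces.eHomBesovNorm s p q`, BCD Def. 2.15), and PROVES from it the
statement it refutes: no uniform small-data control of `‖u(t)‖_{Ḃ^s_{p,∞}}` by `‖u₀‖_{Ḃ^s_{p,1}}` on
any uniform time interval, in any space of the printed supercritical window
(`SupercriticalBesovNormInflation.not_bounded_near_zero`, `supercriticalBesovNormInflationNarrow`),
and the Bourgain–Pavlović extension to `Ḃ^{σ}_{∞,∞}`, `−3 < σ < −1` (`.inflation_top`).

## What is printed (arXiv:2504.08288; "p." = 3000-character chunk of the held text)

* (1.1) (p. 3): NS on `[0,T] × ℝ³`, `∂ₜu − Δu + u·∇u + ∇p = 0`, `div u = 0` (viscosity `1`, no force).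
* **Thm. 1.1** (p. 3, L28–49): "For any `s ≠ 0` and `1 ≤ p, q ≤ ∞` such that `−3 < s − 3/p < −1`,
  the 3D Navier–Stokes equations (1.1) are strongly ill-posed in `Ḃ^s_{p,q}(ℝ³)` in the following
  sense. For any `ε > 0`, there exists a time `0 < t* ≤ ε` and a solution `u` of (1.1) such that the
  following holds. • The solution `u` is smooth on `[0,t*]`, i.e. `u ∈ C^∞([0,t*] × ℝ³)`. • The
  initial data `u|_{t=0} = u₀ ∈ C_c^∞(ℝ³)` and `‖u₀‖_{Ḃ^s_{p,1}(ℝ³)} ≤ ε`. • `u` develops norm inflation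
  at `t = t*`: `‖u(t*)‖_{Ḃ^s_{p,∞}(ℝ³)} ≥ ε⁻¹`." After it: "norm inflation … in `Ḃ^s_{p,q}` near the
  critical line `s = −1 + 3/p` except possibly at `s = 0`. It remains an open question whether such
  norm inflation can occur in supercritical Lebesgue spaces `L^p`, `2 < p < 3`."
* **Rem. 1.2** (p. 3): the upper limit `s = −1 + 3/p` is sharp (small-data continuity of the solution
  map in `B^{−1+3/p}_{p,∞}`, `p < ∞`); "extends the famous `Ḃ^{-1}_{∞,∞}` norm inflation of
  Bourgain–Pavlović to `Ḃ^{-s}_{∞,∞}`, `−3 < s < −1`" [sic: i.e. to `Ḃ^{σ}_{∞,∞}`, `−3 < σ < −1`];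
  the lower limit `s = −3 + 3/p` "appears to be technical" (`L¹ ↪̸ Ḃ^s_{p,q}` below it); the same
  strong ill-posedness in `Ẇ^{s,p}` by embedding; `s > 0`: mixing (forward cascade), `s < 0`:
  un-mixing (backward cascade), "the restriction of `s ≠ 0` is essential in our construction".
* §1.2 (p. 5): "our solutions exhibit only an instantaneous burst of growth. A central open question
  remains: Can solutions to (NS) achieve prolonged, sustained growth or even finite time blowup?"
* §1.3 (p. 5): scheme = approximate system + inflation there + stability: NS → Euler on short times
  in supercritical regimes; Euler → "2D Euler + linear transport" by axisymmetric anisotropy;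
  inflation from the swirl transported by a stationary meridional flow; §2 Prop. 2.1 (approximate
  solution), §3 Prop. 3.1 (`s > 0`), §4 Prop. 4.1 (`s < 0`), §5 Prop. 5.1 (stability, bootstrap
  and energy estimates), §6.1 (proof of Thm. 1.1).

## Rendering (as the Thm. 1.3 sibling; WEAKER than print only where noted)

* Exponents: `s ≠ 0`, `p ∈ [1,∞]` with `−3 < s − 3/p < −1` (for `p = ∞` Lean's
  `3 / (∞).toReal = 0` gives the printed `−3 < s < −1`). The printed `q` plays no rôle in the three
  displayed clauses (smallness in `Ḃ^s_{p,1} ⊂ Ḃ^s_{p,q}`, inflation in `Ḃ^s_{p,∞} ⊃ Ḃ^s_{p,q}`),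
  so it is not a binder of the fact.
* Data: `u₀ ∈ C_c^∞(ℝ³; ℝ³)` (`ContDiff ℝ ∞`, `HasCompactSupport`), divergence free (part of
  "solution of (1.1)"), with tempered distribution `U₀` and `‖U₀‖_{Ḃ^s_{p,1}} ≤ ε`
  (`ENNReal.ofReal ε`).
* Solution: `IsClassicalNSSolutionOn (Icc 0 t*) 1 0 u p'` with `u 0 = u₀` — jointly smooth
  velocity and pressure on `[0,t*] × ℝ³`, pointwise equations, `ν = 1`, unforced = the printed
  "`u ∈ C^∞([0,t*] × ℝ³)`" solution of (1.1) (smoothness of the pressure is implicit in print).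
* Inflation: the slice `u(t*)` has a tempered-distribution representative `Ut` with
  `‖Ut‖_{Ḃ^s_{p,∞}} ≥ ε⁻¹`; `0 < t* ≤ ε`.
* Besov norms are the tree's Littlewood–Paley norms (BCD Def. 2.15), equal to the source's §1.6
  definition up to the choice of the dyadic partition, i.e. up to constants — absorbed in the
  arbitrary `ε` (replace `ε` by `ε/C`).

## References

* X. Luo, *Sharp norm inflation for 3D Navier–Stokes equations in supercritical spaces*,
  arXiv:2504.08288 (2025), Thm. 1.1, Rem. 1.2, §1.2–1.3, §6.1. [`Luo2025`]
* J. Bourgain, N. Pavlović, J. Funct. Anal. 255 (2008), Thm. 1.1. [`BourgainPavlovic2008`]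
* H. Bahouri, J.-Y. Chemin, R. Danchin, GL 343 (2011), Def. 2.15, Prop. 2.20. [`BahouriCheminDanchinGL343`]
* H. Koch, D. Tataru, Adv. Math. 157 (2001), Thm. 2. [`KochTataruAdvMath2001`]
-/

noncomputable section

open MeasureTheory Set
open scoped ENNReal SchwartzMap

namespace Literature.Barriers.NavierStokesRegularity

/-- **Barrier (X. Luo 2025, Thm. 1.1): sharp norm inflation for Navier–Stokes in every
supercritical Besov space `Ḃ^s_{p,q}(ℝ³)`, `s ≠ 0`, `−3 < s − 3/p < −1` — rendering of the module
docstring.** For all such `(s, p)` and every `ε > 0` there are a time `0 < t* ≤ ε`, a `C_c^∞`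
divergence-free datum `u₀ : ℝ³ → ℝ³` whose tempered distribution has `‖·‖_{Ḃ^s_{p,1}} ≤ ε`, and a
classical solution `(u, p')` of the unforced Navier–Stokes equations (`ν = 1`) on `[0,t*] × ℝ³`
with `u(0) = u₀`, whose slice `u(t*)` has a tempered-distribution representative of
`Ḃ^s_{p,∞}`-norm `≥ ε⁻¹`. Printed moreover, not recorded: the dichotomy of mechanisms (`s > 0`
mixing / `s < 0` un-mixing); that `L^p`, `2 < p < 3` (`s = 0`) is OPEN; "only an instantaneous
burst of growth". [cite: Luo2025, Thm. 1.1 with Rem. 1.2 (p. 3 of arXiv:2504.08288), §1.6 (Besov spaces), §6.1 (proof)]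

BARRIER (structured block, D-0021):
technique_class: supercritical-space-wellposedness supercritical-besov-flow-map-continuity supercritical-small-data-apriori-bound small-supercritical-data-short-time-control norm-inflation perturbative-mild-solution-supercritical
blocks: every statement of the shape "for data small in a SUPERCRITICAL norm `‖u₀‖_{Ḃ^s_{p,q}}` (`s ≠ 0`, `−3 < s − 3/p < −1`; `Ẇ^{s,p}` likewise by embedding) smooth solutions stay controlled in `Ḃ^s_{p,∞}` on a uniform short time interval" — continuity at `0` of the data-to-solution map `u₀ ↦ u(t)` from the `Ḃ^s_{p,q}` topology on `C_c^∞` divergence-free data, any small-data local well-posedness / Picard scheme in a path space embedding into `L^∞(0,t₀; Ḃ^s_{p,∞})` with data norm dominated by `‖·‖_{Ḃ^s_{p,1}}`, and any a priori estimate `sup_{t<t₀}‖u(t)‖_{Ḃ^s_{p,∞}} ≤ K` for `‖u₀‖_{Ḃ^s_{p,1}} ≤ ε` (in-tree: `supercriticalBesovNormInflationNarrow`, `SupercriticalBesovNormInflation.not_bounded_near_zero`) [cite: Luo2025, Thm. 1.1]; in particular the weaker-target evasion left open by the critical entry (`CriticalBesovNormInflation`, scope (e): inflation into `Ḃ^{σ}_{∞,∞}`,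 `σ < −1`) is closed for `−3 < σ < −1`: "extends the famous `Ḃ^{-1}_{∞,∞}` norm inflation of Bourgain–Pavlović" (in-tree `SupercriticalBesovNormInflation.inflation_top`) [cite: Luo2025, Rem. 1.2] [cite: BourgainPavlovic2008, Thm. 1.1].
because: in supercritical regimes viscosity is dominated by the nonlinearity over the short time `t* ≤ ε` (NS → Euler); by axisymmetric anisotropy the dynamics reduce to a stationary meridional 2D Euler flow plus LINEAR transport of the swirl; for `s > 0` the non-Lipschitz (supercritically small) meridional flow MIXES the swirl (forward cascade, growth of positive norms, §3 Prop. 3.1), for `s < 0` a prepared swirl UN-mixes (backward cascade, growth of negative norms by duality, §4 Prop. 4.1); a bootstrap/energy argument (§5 Prop. 5.1) keeps the true Navier–Stokes solution close to the approximate one up to `t*` [cite: Luo2025, §1.3 (outline), §3 Prop. 3.1, §4 Prop. 4.1, §5 Prop. 5.1, §6.1].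
evasions_known: (1) CRITICAL or subcritical data topologies: the line `s = −1 + 3/p` is sharp — the solution map is continuous for small data in `B^{−1+3/p}_{p,∞}`, `p < ∞` [cite: Luo2025, Rem. 1.2], and small-data global well-posedness holds in `BMO⁻¹` (in-tree `Literature.Analysis.FluidPDE.koch_tataru`) [cite: KochTataruAdvMath2001, Thm. 2]; (2) `s = 0`: the supercritical LEBESGUE spaces `L^p`, `2 < p < 3`, are NOT covered — "It remains an open question whether such norm inflation can occur in supercritical Lebesgue spaces" [cite: Luo2025, §1 after Thm. 1.1]; (3) the far window `s − 3/p ≤ −3` is not covered ("appears to be technical"; `L¹ ↪̸ Ḃ^s_{p,q}` there) [cite: Luo2025, Rem. 1.2]; (4) the inflation is an INSTANTANEOUS one-shot burst with `t* → 0` — regularity arguments that do not route through small-data control in a supercritical norm are untouched; sustained growth / blow-up is the stated open question [cite: Luo2025, §1.2].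
scope_caveats: (a) `ℝ³`, viscosity `1`, zero force, as printed (other viscosities by the Navier–Stokes scaling, not threaded) [cite: Luo2025, (1.1)]; (b) an ILL-POSEDNESS statement (discontinuity of the solution map at `0` between the named topologies) — no blow-up, no non-uniqueness, nothing about `NavierStokesRegularity` itself, whose data are Schwartz and `O(1)` [cite: Luo2025, Thm. 1.1 and §1.2]; (c) the printed `q` is immaterial to the displayed clauses and is dropped; smallness is recorded in `Ḃ^s_{p,1}` and largeness in `Ḃ^s_{p,∞}` exactly as displayed, in the tree's Littlewood–Paley norms (BCD Def. 2.15) — equivalent to the source's §1.6 norms up to constants absorbed in `ε` [cite: BahouriCheminDanchinGL343, Def. 2.15 and Prop. 2.20]; (d) the witness is recorded as a classical solution on the closed slab with `C_c^∞` datum, as printed ("`u ∈ C^∞([0,t*] × ℝ³)`"); boundedness / decay of `u(t*)` beyond having a tempered-distribution representative is not recorded [cite: Luo2025, Thm. 1.1]; (e) the vorticity-amplification corollary (Thm. 1.3) is the sibling `SupercriticalVorticityBurst`, not restated here [cite: Luo2025, Thm. 1.3].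
status: established -/
def SupercriticalBesovNormInflation : Prop :=
  ∀ (s : ℝ) (p : ℝ≥0∞) [Fact (1 ≤ p)], s ≠ 0 →
    -3 < s - 3 / p.toReal → s - 3 / p.toReal < -1 →
    ∀ ε : ℝ, 0 < ε →
      ∃ (tstar : ℝ) (u₀ : EuclideanSpace ℝ (Fin 3) → EuclideanSpace ℝ (Fin 3))
        (U₀ : 𝓢'(EuclideanSpace ℝ (Fin 3), EuclideanSpace ℂ (Fin 3)))
        (u : ℝ → EuclideanSpace ℝ (Fin 3) → EuclideanSpace ℝ (Fin 3))
        (p' : ℝ → EuclideanSpace ℝ (Fin 3) → ℝ)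
        (Ut : 𝓢'(EuclideanSpace ℝ (Fin 3), EuclideanSpace ℂ (Fin 3))),
        0 < tstar ∧ tstar ≤ ε ∧
        ContDiff ℝ ((⊤ : ℕ∞) : WithTop ℕ∞) u₀ ∧ HasCompactSupport u₀ ∧
        Literature.Analysis.FluidPDE.VectorCalculus.IsDivFree u₀ ∧
        Literature.Analysis.FluidPDE.IsDistributionOf u₀ U₀ ∧
        Literature.Analysis.FunctionSpaces.eHomBesovNorm s p 1 U₀ ≤ ENNReal.ofReal ε ∧
        Literature.Analysis.FluidPDE.IsClassicalNSSolutionOn (Icc 0 tstar) 1 0 u p' ∧ u 0 = u₀ ∧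
        Literature.Analysis.FluidPDE.IsDistributionOf (u tstar) Ut ∧
        ENNReal.ofReal ε⁻¹ ≤ Literature.Analysis.FunctionSpaces.eHomBesovNorm s p ∞ Ut

/-- **Reformulation (discontinuity of the solution map at `0`; X. Luo 2025, Thm. 1.1 "strongly
ill-posed").** For `(s, p)` in the printed window there is NO `δ > 0` such that every classical
solution on a slab `[0,t] × ℝ³`, `t ≤ δ`, from a `C_c^∞` divergence-free datum of `Ḃ^s_{p,1}`-norm
`≤ δ` has, for every tempered-distribution representative of its slice `u(t)`, `Ḃ^s_{p,∞}`-norm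
`< 1/δ`. Proved from the barrier fact. [cite: Luo2025, Thm. 1.1] -/
theorem SupercriticalBesovNormInflation.not_bounded_near_zero (h : SupercriticalBesovNormInflation)
    (s : ℝ) (p : ℝ≥0∞) [Fact (1 ≤ p)] (hs : s ≠ 0) (h₁ : -3 < s - 3 / p.toReal)
    (h₂ : s - 3 / p.toReal < -1) :
    ¬ ∃ δ : ℝ, 0 < δ ∧
      ∀ (t : ℝ) (u₀ : EuclideanSpace ℝ (Fin 3) → EuclideanSpace ℝ (Fin 3))
        (U₀ : 𝓢'(EuclideanSpace ℝ (Fin 3), EuclideanSpace ℂ (Fin 3)))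
        (u : ℝ → EuclideanSpace ℝ (Fin 3) → EuclideanSpace ℝ (Fin 3))
        (p' : ℝ → EuclideanSpace ℝ (Fin 3) → ℝ)
        (Ut : 𝓢'(EuclideanSpace ℝ (Fin 3), EuclideanSpace ℂ (Fin 3))),
        0 < t → t ≤ δ → ContDiff ℝ ((⊤ : ℕ∞) : WithTop ℕ∞) u₀ → HasCompactSupport u₀ →
        Literature.Analysis.FluidPDE.VectorCalculus.IsDivFree u₀ →
        Literature.Analysis.FluidPDE.IsDistributionOf u₀ U₀ →
        Literature.Analysis.FunctionSpaces.eHomBesovNorm s p 1 U₀ ≤ ENNReal.ofReal δ →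
        Literature.Analysis.FluidPDE.IsClassicalNSSolutionOn (Icc 0 t) 1 0 u p' → u 0 = u₀ →
        Literature.Analysis.FluidPDE.IsDistributionOf (u t) Ut →
        Literature.Analysis.FunctionSpaces.eHomBesovNorm s p ∞ Ut < ENNReal.ofReal δ⁻¹ := by
  rintro ⟨δ, hδ, hall⟩
  obtain ⟨tstar, u₀, U₀, u, p', Ut, ht, htε, hsm, hcs, hdiv, hdist, hsmall, hsol, hinit, hUt, hbig⟩ :=
    h s p hs h₁ h₂ δ hδ
  exact absurd (hall tstar u₀ U₀ u p' Ut ht htε hsm hcs hdiv hdist hsmall hsol hinit hUt)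
    (not_lt.2 hbig)

/-- **Barrier, narrowed technique class: no uniform small-data control of the `Ḃ^s_{p,∞}` norm on
a uniform time interval in the supercritical window.** For `(s, p)` as printed there are NO
`t₀ > 0`, `ε > 0` and `K` such that every classical solution `(u, p')` of the unforced
Navier–Stokes equations (`ν = 1`) on `[0,t] × ℝ³`, `t ≤ t₀`, from a `C_c^∞` divergence-free datum
`u₀` with `‖u₀‖_{Ḃ^s_{p,1}} ≤ ε` has `‖u(t)‖_{Ḃ^s_{p,∞}} ≤ K` (for every tempered-distribution
representative of the slice). This is the a priori bound that Theorem 1.1 refutes (take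
`δ < min(t₀, ε, 1/(|K|+1))` in the fact) — the supercritical twin of
`criticalBesovNormInflationNarrow`. Zero fact debt: PROVED from the vendored fact. [cite: Luo2025, Thm. 1.1 and Rem. 1.2] -/
theorem supercriticalBesovNormInflationNarrow (h : SupercriticalBesovNormInflation)
    (s : ℝ) (p : ℝ≥0∞) [Fact (1 ≤ p)] (hs : s ≠ 0) (h₁ : -3 < s - 3 / p.toReal)
    (h₂ : s - 3 / p.toReal < -1) :
    ¬ ∃ (t₀ ε K : ℝ), 0 < t₀ ∧ 0 < ε ∧
      ∀ (t : ℝ) (u₀ : EuclideanSpace ℝ (Fin 3) → EuclideanSpace ℝ (Fin 3))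
        (U₀ : 𝓢'(EuclideanSpace ℝ (Fin 3), EuclideanSpace ℂ (Fin 3)))
        (u : ℝ → EuclideanSpace ℝ (Fin 3) → EuclideanSpace ℝ (Fin 3))
        (p' : ℝ → EuclideanSpace ℝ (Fin 3) → ℝ)
        (Ut : 𝓢'(EuclideanSpace ℝ (Fin 3), EuclideanSpace ℂ (Fin 3))),
        0 < t → t ≤ t₀ → ContDiff ℝ ((⊤ : ℕ∞) : WithTop ℕ∞) u₀ → HasCompactSupport u₀ →
        Literature.Analysis.FluidPDE.VectorCalculus.IsDivFree u₀ →
        Literature.Analysis.FluidPDE.IsDistributionOf u₀ U₀ →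
        Literature.Analysis.FunctionSpaces.eHomBesovNorm s p 1 U₀ ≤ ENNReal.ofReal ε →
        Literature.Analysis.FluidPDE.IsClassicalNSSolutionOn (Icc 0 t) 1 0 u p' → u 0 = u₀ →
        Literature.Analysis.FluidPDE.IsDistributionOf (u t) Ut →
        Literature.Analysis.FunctionSpaces.eHomBesovNorm s p ∞ Ut ≤ ENNReal.ofReal K := by
  rintro ⟨t₀, ε, K, ht₀, hε, hall⟩
  have hK1 : 0 < |K| + 1 := by positivity
  set δ : ℝ := min (min t₀ ε) (1 / (|K| + 1)) with hδ_def
  have hδpos : 0 < δ := lt_min (lt_min ht₀ hε) (by positivity)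
  have hδt : δ ≤ t₀ := (min_le_left _ _).trans (min_le_left _ _)
  have hδε : δ ≤ ε := (min_le_left _ _).trans (min_le_right _ _)
  have hδK' : δ ≤ 1 / (|K| + 1) := min_le_right _ _
  have hmul : δ * (|K| + 1) ≤ 1 := by
    calc δ * (|K| + 1) ≤ 1 / (|K| + 1) * (|K| + 1) := by gcongr
      _ = 1 := by field_simp
  have hδK : K < δ⁻¹ := by
    rw [← one_div, lt_div_iff₀ hδpos]
    nlinarith [le_abs_self K, mul_le_mul_of_nonneg_right (le_abs_self K) hδpos.le]
  obtain ⟨tstar, u₀, U₀, u, p', Ut, ht, htδ, hsm, hcs, hdiv, hdist, hsmall, hsol, hinit, hUt, hbig⟩ :=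
    h s p hs h₁ h₂ δ hδpos
  have hbound := hall tstar u₀ U₀ u p' Ut ht (htδ.trans hδt) hsm hcs hdiv hdist
    (hsmall.trans (ENNReal.ofReal_le_ofReal hδε)) hsol hinit hUt
  exact absurd (hbig.trans hbound)
    (not_le.2 ((ENNReal.ofReal_lt_ofReal_iff (inv_pos.2 hδpos)).2 hδK))

/-- **The Bourgain–Pavlović extension (Rem. 1.2): norm inflation in `Ḃ^{σ}_{∞,∞}(ℝ³)` for every
`−3 < σ < −1`.** The case `p = ∞` of the fact (Lean: `3 / (∞).toReal = 0`): for every such `σ`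
and every `ε > 0`, a classical solution from a `C_c^∞` divergence-free datum with
`‖u₀‖_{Ḃ^σ_{∞,1}} ≤ ε` reaches `‖u(t*)‖_{Ḃ^σ_{∞,∞}} ≥ ε⁻¹` at some `0 < t* ≤ ε` — the weaker-target
clause that `CriticalBesovNormInflation` (σ = −1) leaves open in its scope (e).
[cite: Luo2025, Rem. 1.2 and Thm. 1.1] [cite: BourgainPavlovic2008, Thm. 1.1] -/
theorem SupercriticalBesovNormInflation.inflation_top (h : SupercriticalBesovNormInflation)
    {σ : ℝ} (hσ₁ : -3 < σ) (hσ₂ : σ < -1) {ε : ℝ} (hε : 0 < ε) :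
    ∃ (tstar : ℝ) (u₀ : EuclideanSpace ℝ (Fin 3) → EuclideanSpace ℝ (Fin 3))
      (U₀ : 𝓢'(EuclideanSpace ℝ (Fin 3), EuclideanSpace ℂ (Fin 3)))
      (u : ℝ → EuclideanSpace ℝ (Fin 3) → EuclideanSpace ℝ (Fin 3))
      (p' : ℝ → EuclideanSpace ℝ (Fin 3) → ℝ)
      (Ut : 𝓢'(EuclideanSpace ℝ (Fin 3), EuclideanSpace ℂ (Fin 3))),
      0 < tstar ∧ tstar ≤ ε ∧
      ContDiff ℝ ((⊤ : ℕ∞) : WithTop ℕ∞) u₀ ∧ HasCompactSupport u₀ ∧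
      Literature.Analysis.FluidPDE.VectorCalculus.IsDivFree u₀ ∧
      Literature.Analysis.FluidPDE.IsDistributionOf u₀ U₀ ∧
      Literature.Analysis.FunctionSpaces.eHomBesovNorm σ ∞ 1 U₀ ≤ ENNReal.ofReal ε ∧
      Literature.Analysis.FluidPDE.IsClassicalNSSolutionOn (Icc 0 tstar) 1 0 u p' ∧ u 0 = u₀ ∧
      Literature.Analysis.FluidPDE.IsDistributionOf (u tstar) Ut ∧
      ENNReal.ofReal ε⁻¹ ≤ Literature.Analysis.FunctionSpaces.eHomBesovNorm σ ∞ ∞ Ut := by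
  have hσ0 : σ ≠ 0 := by
    intro h0
    rw [h0] at hσ₂
    linarith
  have h₁ : -3 < σ - 3 / (∞ : ℝ≥0∞).toReal := by simpa using hσ₁
  have h₂ : σ - 3 / (∞ : ℝ≥0∞).toReal < -1 := by simpa using hσ₂
  exact h σ ∞ hσ0 h₁ h₂ ε hε

end Literature.Barriers.NavierStokesRegularity
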